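import Summits.ABC.IUTFork.Repair.RHLinearReachLawExact
import HarnessLib

/-!
# D-0079 RESCUE sub-cell R-H, row 20 `linear-reach-law` AT EVERY PRIME — `RHLinearReachLawMixed` (1/2: the candidate):
# the per-SUMMAND (mixed-place) exact reach cell `MixedReachCell` / `CellReachMixAt` and the datum-level candidate `HStarReachMix`

[R-H candidate — a HYPOTHESIS, claim-tagged `def … : Prop`; never a Literature fact; typed ≠ proved; instantiated ≠ endorsed.] Seat abc-iut-rh-typ-7 gen 4
(R-H ROUND 2 support hand of the row-20 lineage; lead abc-iut-rh-lead g2; consumer abc-iut-rh2-q2-hull). TAKES NO SIDE on [IUTchIII] Cor. 3.12 or on any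
author; nothing here asserts abc proved or refuted. Companion 2/2 `Repair/RHLinearReachLawMixedDoor.lean` (PROOF-ONLY: the door at any prime and the hSHw body).

WHY. Row 20's exact cell `CellReachAt X p i x` (p465403) and its door (p470484, abc-iut-rp-d3 p465556/p466561) serve ONE-PLACE bad packets only (`huniq`):
the (Ind2) level-weights door freed from `huniq` by abc-iut-rp-d3 (`RHMultiReachFree` §2, p467833) asks integer level weights on EVERY summand
`v⃗ = (v_a)_{a ∈ S^±_{j+1}}` of the packet `(j, p)`, and at a SPLIT prime the slots of a summand sit at DIFFERENT places over `p`. Reading that door's two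
product inequalities through `‖ϖ_a‖ = p^{−1/e_a}`, the conductor witness (`‖y_a‖ ≤ ‖ϖ_a‖^{c_a−1}`, `y_a ∉ log_p𝒪^×`) and the extremal log-unit
(`‖z_a‖ = ‖ϖ_a‖^{B_a}`) of each slot's place, and the realising norms `‖t_q‖ = p^{−μ}`, `‖t_{Θ,j}‖ = p^{−j²μ}` (`μ = ord(q)/(2l·e)` at the LAST slot's place),
the honest per-summand cell is the RATIONAL MIXED CELL
  `∃ K ∈ ℤ, j²·μ ≤ K + Σ_a (1 + (c_a − 1)/e_a) ∧ K + Σ_a B_a/e_a ≤ μ`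
(only the total level `K = Σ_a k_a` matters). It is EXACTLY «integer level weights exist on that summand» — by abc-iut-rp-d3's `RHLevelMoverTight` (p468542)
the pure-tensor mover method reaches no further — and on a DIAGONAL summand (all slots at one place) it is row 20's `ReachCell e c B j m` / `ReachCell2l`
(multiply by `e`, resp. `2l·e`). So `HStarReachMix` := «the mixed cell on every bad-last summand of every packet» is row 20 COMPLETED TO SPLIT PRIMES: it
refines `HStarReach` (diagonal summands), agrees with it at one-place primes, and — companion file — gives the hSHw body at EVERY prime with NO
unique-place hypothesis and NO «2l ∣ ord(q)» binder (the depth enters as the rational `μ`).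

WHAT IS HERE (namespace `Summit.ABC.IUTFork.Repair.RH.LinearReachLaw`):
* §M1 `MixedReachCell α β j μ` (rational cell of one summand) · `mixedReachCell_iff_ceil_le_floor` (DECIDER `⌈j²μ − Σ(1+α)⌉ ≤ ⌊μ − Σβ⌋`) ·
  `mixedReachCell_const_iff` / `…_iff_reachCell` / `…_iff_reachCell2l` (constant slot data = row 20's integer cells).
* §M2 `CellReachMixAt X p i v⃗` (claim-tagged: ∀ uniformizer families, ∀ certified inner conductors / outer orders of the slots' places ⟹ the rational
  cell; `e_a = e(v_a|p)`, `μ = ord_{v_last}(q)/(2l·e_{v_last})`) · `HStarReachMix X` (claim-tagged) · `cellReachMixAt_iff_of_certs` (DECIDER at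
  certified integers) · `cellReachAt_iff_cellReachMixAt_const` (diagonal summand ⟺ `CellReachAt`) · `hStarReach_of_hStarReachMix`.
Σ-READING. Σ₂₀^mix (datum level) := data all of whose bad-last summands satisfy the cell; per summand it is decided from the SAME columns as Σ₂₀
(`e_w`, `r_in_ub`, `r_out_sharp`, `H`, `l`, `j`) read per place-TUPLE; on Galois-homogeneous fibres (all places over `p` of one type) Σ₂₀^mix = Σ₂₀.
No k1 claim (the A6 ceiling of S_H-sufficient cells stands: row 20 exact cell 55.1 % pooled v1); no new row number (round-2 ruling R7).
[cite: Mochizuki2012, IUTchI Ex. 3.2 (iv) p. 71; IUTchIII Thm. 3.11 (i) (Ind2) p. 154] [cite: NeukirchANT1999, Ch. II (5.5)] [cite: DupuyHilado2025, §3.9, §4.9]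
[claim: Mochizuki2012, status: disputed] for every IUT sentence quoted. 0 sorry; standard axioms.
-/

noncomputable section

open Set Metric Function NumberField IsDedekindDomain
open scoped Pointwise

namespace Summit.ABC.IUTFork.Repair.RH.LinearReachLaw

open Literature.IUT.LogVolume Literature.NumberTheory.GaloisRepresentations.Ultrametric

/-! ## §M1. The rational mixed reach cell of ONE summand (slots at possibly different places over `p`) -/

/-- **MIXED (per-summand) REACH CELL, rational form.** Slots `a ∈ ι` (the `j+1` tensor slots of a summand at label `j`) carry the INNER exponent
`α a = (c_a − 1)/e_a` and the OUTER exponent `β a = B_a/e_a` of `log_p(𝒪^×)` at slot `a`'s place (`p`-adic valuation units); the LAST slot's place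
carries the `q`-depth `μ = ord(q)/(2l·e)` (`‖t_q‖ = p^{−μ}`, `‖t_{Θ,j}‖ = p^{−j²μ}`). The cell: SOME integer total level `K` has `j²·μ ≤ K + Σ_a (1 + α a)`
(the pure tensor of the re-levelled conductor witnesses fits the Θ-box) and `K + Σ_a β a ≤ μ` (its (Ind2)-reach dominates `t_q`) — EXACTLY «integer level
weights exist on this summand» (abc-iut-rp-d3 `RHMultiReachFree` §2; only `Σ_a k_a` matters). On a DIAGONAL summand it is row 20's `ReachCell` /
`ReachCell2l` (`mixedReachCell_const_iff_reachCell(2l)`). Candidate vocabulary; asserts nothing. [cite: Mochizuki2012, IUTchIII Thm. 3.11 (i) (Ind2) p. 154]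
[claim: Mochizuki2012, status: disputed] -/
def MixedReachCell {ι : Type*} [Fintype ι] (α β : ι → ℚ) (j : ℕ) (μ : ℚ) : Prop :=
  ∃ K : ℤ, (j : ℚ) ^ 2 * μ ≤ (K : ℚ) + ∑ a, (1 + α a) ∧ (K : ℚ) + ∑ a, β a ≤ μ

/-- **DECIDER**: the mixed cell holds iff `⌈j²μ − Σ_a (1 + α a)⌉ ≤ ⌊μ − Σ_a β a⌋`. [folklore] -/
theorem mixedReachCell_iff_ceil_le_floor {ι : Type*} [Fintype ι] (α β : ι → ℚ) (j : ℕ) (μ : ℚ) :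
    MixedReachCell α β j μ ↔ ⌈(j : ℚ) ^ 2 * μ - ∑ a, (1 + α a)⌉ ≤ ⌊μ - ∑ a, β a⌋ := by
  constructor
  · rintro ⟨K, h1, h2⟩
    exact (Int.ceil_le.2 (by linarith)).trans (Int.le_floor.2 (by linarith))
  · intro h
    refine ⟨⌈(j : ℚ) ^ 2 * μ - ∑ a, (1 + α a)⌉, ?_, ?_⟩
    · have := Int.le_ceil ((j : ℚ) ^ 2 * μ - ∑ a, (1 + α a)); linarith
    · have h' : ((⌈(j : ℚ) ^ 2 * μ - ∑ a, (1 + α a)⌉ : ℤ) : ℚ) ≤ ⌊μ - ∑ a, β a⌋ := by exact_mod_cast h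
      have := Int.floor_le (μ - ∑ a, β a); linarith

/-- **CONSTANT SLOT DATA** (all `j+1` slots at ONE place, common denominator `D > 0`): the mixed cell with `α ≡ A/D`, `β ≡ B/D`, `μ = M/D` is
`∃ K, j²·M ≤ D·K + (j+1)·(D + A) ∧ D·K + (j+1)·B ≤ M`. [folklore] -/
theorem mixedReachCell_const_iff {ι : Type*} [Fintype ι] {j : ℕ} (hι : Fintype.card ι = j + 1) {D : ℚ} (hD : 0 < D) (A B M : ℚ) :
    MixedReachCell (fun _ : ι => A / D) (fun _ : ι => B / D) j (M / D) ↔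
      ∃ K : ℤ, (j : ℚ) ^ 2 * M ≤ D * K + ((j : ℚ) + 1) * (D + A) ∧ D * K + ((j : ℚ) + 1) * B ≤ M := by
  have hcard : ((Finset.univ : Finset ι).card : ℚ) = (j : ℚ) + 1 := by rw [Finset.card_univ, hι]; push_cast; ring
  unfold MixedReachCell
  simp only [Finset.sum_const, nsmul_eq_mul, hcard]
  have hAD : (1 + A / D) * D = D + A := by rw [add_mul, one_mul, div_mul_cancel₀ _ hD.ne']
  have hBD : B / D * D = B := div_mul_cancel₀ _ hD.ne'
  have hx1 : ∀ K : ℤ, ((K : ℚ) + ((j : ℚ) + 1) * (1 + A / D)) * D = D * K + ((j : ℚ) + 1) * (D + A) := fun K => by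
    calc ((K : ℚ) + ((j : ℚ) + 1) * (1 + A / D)) * D = (K : ℚ) * D + ((j : ℚ) + 1) * ((1 + A / D) * D) := by ring
      _ = D * K + ((j : ℚ) + 1) * (D + A) := by rw [hAD]; ring
  have hx2 : ∀ K : ℤ, ((K : ℚ) + ((j : ℚ) + 1) * (B / D)) * D = D * K + ((j : ℚ) + 1) * B := fun K => by
    calc ((K : ℚ) + ((j : ℚ) + 1) * (B / D)) * D = (K : ℚ) * D + ((j : ℚ) + 1) * (B / D * D) := by ring
      _ = D * K + ((j : ℚ) + 1) * B := by rw [hBD]; ring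
  refine exists_congr fun K => and_congr ?_ ?_
  · rw [← mul_div_assoc, div_le_iff₀ hD, hx1]
  · rw [le_div_iff₀ hD, hx2]

/-- **DIAGONAL SUMMAND = ROW 20's CELL** (`μ = m/e`): `MixedReachCell ((c−1)/e) (B/e) j (m/e) ⟺ ReachCell e c B j m`. [folklore] -/
theorem mixedReachCell_const_iff_reachCell {ι : Type*} [Fintype ι] {j : ℕ} (hι : Fintype.card ι = j + 1) {e : ℤ} (he : 0 < e)
    (c B m : ℤ) : MixedReachCell (fun _ : ι => ((c : ℚ) - 1) / e) (fun _ : ι => (B : ℚ) / e) j ((m : ℚ) / e) ↔ ReachCell e c B j m := by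
  rw [mixedReachCell_const_iff hι (by exact_mod_cast he : (0 : ℚ) < e)]
  refine exists_congr fun K => and_congr ?_ ?_
  · constructor
    · intro h; exact_mod_cast (show ((j : ℚ) ^ 2 * m : ℚ) ≤ e * K + ((j : ℚ) + 1) * (c + e - 1) by linarith)
    · intro h
      have h' : ((j : ℚ) ^ 2 * m : ℚ) ≤ e * K + ((j : ℚ) + 1) * (c + e - 1) := by exact_mod_cast h
      linarith
  · exact ⟨fun h => by exact_mod_cast h, fun h => by exact_mod_cast h⟩

/-- **DIAGONAL SUMMAND = ROW 20's `2l`-CLEARED CELL** (`μ = ord(q)/(2l·e)`, no divisibility assumption):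
`MixedReachCell ((c−1)/e) (B/e) j (ord(q)/(2l·e)) ⟺ ReachCell2l e c B j ord(q) l`. [folklore] -/
theorem mixedReachCell_const_iff_reachCell2l {ι : Type*} [Fintype ι] {j : ℕ} (hι : Fintype.card ι = j + 1) {e : ℤ} (he : 0 < e)
    {l : ℕ} (hl : 0 < l) (c B ordq : ℤ) :
    MixedReachCell (fun _ : ι => ((c : ℚ) - 1) / e) (fun _ : ι => (B : ℚ) / e) j ((ordq : ℚ) / (2 * l * e)) ↔
      ReachCell2l e c B j ordq l := by
  have he' : (0 : ℚ) < e := by exact_mod_cast he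
  have hl' : (0 : ℚ) < 2 * l := by positivity
  have hD : (0 : ℚ) < 2 * l * e := by positivity
  -- rewrite the slot data over the common denominator `2l·e`
  have h1 : (fun _ : ι => ((c : ℚ) - 1) / e) = fun _ : ι => (2 * l * ((c : ℚ) - 1)) / (2 * l * e) := by
    funext; rw [mul_div_mul_left _ _ hl'.ne']
  have h2 : (fun _ : ι => (B : ℚ) / e) = fun _ : ι => (2 * l * (B : ℚ)) / (2 * l * e) := by
    funext; rw [mul_div_mul_left _ _ hl'.ne']
  rw [h1, h2, mixedReachCell_const_iff hι hD]
  refine exists_congr fun K => and_congr ?_ ?_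
  · constructor
    · intro h
      exact_mod_cast (show ((j : ℚ) ^ 2 * ordq : ℚ) ≤ 2 * l * (e * K + ((j : ℚ) + 1) * (c + e - 1)) by linarith)
    · intro h
      have h' : ((j : ℚ) ^ 2 * ordq : ℚ) ≤ 2 * l * (e * K + ((j : ℚ) + 1) * (c + e - 1)) := by exact_mod_cast h
      linarith
  · constructor
    · intro h; exact_mod_cast (show (2 * l * (e * K + ((j : ℚ) + 1) * B) : ℚ) ≤ ordq by linarith)
    · intro h
      have h' : (2 * l * (e * K + ((j : ℚ) + 1) * B) : ℚ) ≤ ordq := by exact_mod_cast h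
      linarith

/-! ## §M2. The candidate at a pilot datum: the mixed cell of a summand, and H⋆₂₀-MIX -/

section Candidate

open Literature.IUT.LogThetaLattice Thm311 Thm311.Real Cor312 Cor312.Setting Cor312Vol Cor312Prov
  Summit.ABC.IUTFork.Repair.RH.ShellCapacityPlus

variable {F : Type} [Field F] [NumberField F] (X : PilotData F)

/-- **THE MIXED REACH CELL OF A SUMMAND `v⃗ = (ev a)_a` of the packet `(i+1, p)`** (slots `a ∈ S^±_{i+2}`, places `ev a ∣ p`, last slot at a bad place):
for every family of norm uniformizers `ϖ_a` of `K_{ev a}` and THE inner conductors `c_a` / outer orders `B_a` of `log_p(𝒪_{ev a}^×)`, the rational mixed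
cell with `α a = (c_a − 1)/e_{ev a}`, `β a = B_a/e_{ev a}`, `μ = ord_{ev(last)}(q)/(2l·e_{ev(last)})`. Row 20's `CellReachAt X p i x` is its value on the
diagonal summand `ev ≡ x` (`cellReachAt_iff_cellReachMixAt_const`). A claim-tagged HYPOTHESIS; asserts nothing.
[cite: Mochizuki2012, IUTchIII Thm. 3.11 (i) (Ind2) p. 154] [claim: Mochizuki2012, status: disputed] -/
@[claim "Mochizuki2012" "disputed"]
def CellReachMixAt (pp : Nat.Primes) (i : Fin X.lstar)
    (ev : (thetaIndex X).Caps (Setting.labelSucc i) → (thetaIndex X).Fibre (.inr pp)) : Prop :=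
  haveI : Fact (pp : ℕ).Prime := ⟨pp.2⟩
  ∀ (ϖ : ∀ a, (kOf X pp.1 (ev a))ˣ), (∀ a, IsUniformizer (ϖ a)) →
    ∀ (c : (thetaIndex X).Caps (Setting.labelSucc i) → ℕ) (B : (thetaIndex X).Caps (Setting.labelSucc i) → ℤ),
      (∀ a, IsInnerConductor (kOf X pp.1 (ev a)) (ϖ a) (c a)) → (∀ a, IsOuterOrder (kOf X pp.1 (ev a)) (ϖ a) (B a)) →
        MixedReachCell (fun a => ((c a : ℚ) - 1) / ((placeOf X pp.1 (ev a)).asIdeal.ramificationIdx ℤ : ℚ))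
          (fun a => (B a : ℚ) / ((placeOf X pp.1 (ev a)).asIdeal.ramificationIdx ℤ : ℚ)) ((i : ℕ) + 1)
          ((X.ordq (placeOf X pp.1 (ev (Fin.last _))) : ℚ) /
            (2 * X.l * ((placeOf X pp.1 (ev (Fin.last _))).asIdeal.ramificationIdx ℤ : ℚ)))

/-- **H⋆₂₀-MIX «reach cell at every prime»**: the mixed cell on EVERY summand (of every packet `(i+1, p)`) whose last slot sits at a bad place. At a
prime with ONE place over it this is row 20's `HStarReach` there; in general it REFINES `HStarReach` (`hStarReach_of_hStarReachMix`). A claim-tagged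
HYPOTHESIS; never asserted; instantiate `X := Cor312Prov.pilotDataOfK D K`. [cite: Mochizuki2012, IUTchIII Thm. 3.11 (i) (Ind2) p. 154]
[claim: Mochizuki2012, status: disputed] -/
@[claim "Mochizuki2012" "disputed"]
def HStarReachMix : Prop :=
  ∀ (pp : Nat.Primes) (i : Fin X.lstar) (ev : (thetaIndex X).Caps (Setting.labelSucc i) → (thetaIndex X).Fibre (.inr pp)),
    haveI : Fact (pp : ℕ).Prime := ⟨pp.2⟩
    placeOf X pp.1 (ev (Fin.last _)) ∈ X.S → CellReachMixAt X pp i ev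

/-- **DECIDER**: once ONE uniformizer family and THE lattice integers of every slot are certified, the mixed cell IS the rational cell at those integers.
[folklore] -/
theorem cellReachMixAt_iff_of_certs (pp : Nat.Primes) [Fact (pp : ℕ).Prime] (i : Fin X.lstar)
    (ev : (thetaIndex X).Caps (Setting.labelSucc i) → (thetaIndex X).Fibre (.inr pp))
    {ϖ : ∀ a, (kOf X pp.1 (ev a))ˣ} (hϖ : ∀ a, IsUniformizer (ϖ a))
    {c₀ : (thetaIndex X).Caps (Setting.labelSucc i) → ℕ} {B₀ : (thetaIndex X).Caps (Setting.labelSucc i) → ℤ}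
    (hc : ∀ a, IsInnerConductor (kOf X pp.1 (ev a)) (ϖ a) (c₀ a)) (hB : ∀ a, IsOuterOrder (kOf X pp.1 (ev a)) (ϖ a) (B₀ a)) :
    CellReachMixAt X pp i ev ↔
      MixedReachCell (fun a => ((c₀ a : ℚ) - 1) / ((placeOf X pp.1 (ev a)).asIdeal.ramificationIdx ℤ : ℚ))
        (fun a => (B₀ a : ℚ) / ((placeOf X pp.1 (ev a)).asIdeal.ramificationIdx ℤ : ℚ)) ((i : ℕ) + 1)
        ((X.ordq (placeOf X pp.1 (ev (Fin.last _))) : ℚ) /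
          (2 * X.l * ((placeOf X pp.1 (ev (Fin.last _))).asIdeal.ramificationIdx ℤ : ℚ))) := by
  constructor
  · intro h; exact h ϖ hϖ c₀ B₀ hc hB
  · intro h ϖ' hϖ' c B hc' hB'
    have hcc : c = c₀ := funext fun a => by
      have hn := norm_eq_norm_of_isUniformizer (kOf X pp.1 (ev a)) (hϖ' a) (hϖ a)
      exact isInnerConductor_unique ((isInnerConductor_congr hn _).1 (hc' a)) (hc a)
    have hBB : B = B₀ := funext fun a => by
      have hn := norm_eq_norm_of_isUniformizer (kOf X pp.1 (ev a)) (hϖ' a) (hϖ a)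
      exact isOuterOrder_unique (hϖ a) ((isOuterOrder_congr hn _).1 (hB' a)) (hB a)
    subst hcc hBB
    exact h

/-- **DIAGONAL SUMMAND ⟺ ROW 20's EXACT CELL**: on `ev ≡ x` the mixed cell IS `CellReachAt X p i x` (the `2l`-cleared form, NO divisibility assumption).
[folklore] -/
theorem cellReachAt_iff_cellReachMixAt_const (pp : Nat.Primes) [Fact (pp : ℕ).Prime] (i : Fin X.lstar) (x : (thetaIndex X).Fibre (.inr pp)) :
    CellReachAt X pp i x ↔ CellReachMixAt X pp i (fun _ => x) := by
  have hl : 0 < X.l := by have := X.five_le_l; omega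
  have he : (0 : ℤ) < ((placeOf X pp.1 x).asIdeal.ramificationIdx ℤ : ℤ) := by exact_mod_cast Ideal.ramificationIdx_pos _ _
  have hcard : Fintype.card ((thetaIndex X).Caps (Setting.labelSucc i)) = ((i : ℕ) + 1) + 1 := by
    show Fintype.card (Fin (((Fin.succ i : Fin (X.lstar + 1)) : ℕ) + 1)) = _
    rw [Fintype.card_fin, Fin.val_succ]
  have hϖ := isUniformizer_unifChoice (kOf X pp.1 x)
  obtain ⟨c, hc⟩ := exists_isInnerConductor (pp : ℕ) hϖ
  obtain ⟨B, hB⟩ := exists_isOuterOrder (pp : ℕ) hϖ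
  rw [cellReachAt_iff_of_certs X pp i x hϖ hc hB,
    cellReachMixAt_iff_of_certs X pp i (fun _ => x) (ϖ := fun _ => unifChoice (kOf X pp.1 x)) (fun _ => hϖ) (c₀ := fun _ => c)
      (B₀ := fun _ => B) (fun _ => hc) (fun _ => hB)]
  have := mixedReachCell_const_iff_reachCell2l (ι := (thetaIndex X).Caps (Setting.labelSucc i)) hcard he hl (c : ℤ) B
    (X.ordq (placeOf X pp.1 x))
  push_cast at this ⊢
  exact this.symm

/-- **`HStarReachMix X → HStarReach X`**: the any-prime candidate REFINES row 20's exact candidate (diagonal summands). [folklore] -/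
theorem hStarReach_of_hStarReachMix (h : HStarReachMix X) : HStarReach X := fun pp i x hx => by
  haveI : Fact (pp : ℕ).Prime := ⟨pp.2⟩
  exact (cellReachAt_iff_cellReachMixAt_const X pp i x).2 (h pp i (fun _ => x) hx)

end Candidate

end Summit.ABC.IUTFork.Repair.RH.LinearReachLaw

end
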